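import Mathlib.Analysis.Normed.Group.Ultra
import Mathlib.Analysis.Normed.Field.Basic
import Mathlib.Analysis.Normed.Group.InfiniteSum
import Mathlib.Analysis.SpecificLimits.Basic
import Mathlib.Topology.Algebra.InfiniteSum.NatInt
import HarnessLib

/-!
# `WallLemma` (item stmt-Langlands-8576, support of route `TriangulineChamber`) — PROOF

The adic WALL LEMMA behind the comb picture of the route's card: a Laurent series `∑ₙ aₙ zⁿ`
(`n ∈ ℤ`) over a complete ultrametric field `C`, power-bounded by `1` on the OPEN annulus
`r < |z| < 1` in the sense `‖aₙ‖ sⁿ ≤ 1` for every radius `r < s < 1` and every `n ∈ ℤ`, has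
constant reduction there: for every `x` with `r < ‖x‖ < 1` the series `∑ₙ aₙ xⁿ` converges and
`‖∑ₙ aₙ xⁿ − a₀‖ < 1`.

## Proof
Put `t = ‖x‖` and pick the two auxiliary radii `s₁ = (t+1)/2 ∈ (t, 1)` and `s₂ = (r+t)/2 ∈ (r, t)`.
The one-term estimate `norm_mul_zpow_le` (`‖a‖ sᵐ ≤ 1 ⇒ ‖a xᵐ‖ ≤ (‖x‖/s)ᵐ`, any `m ∈ ℤ`, `s > 0`)
at `s = s₁` bounds the terms of positive index `m = n+1` by `q₁^{n+1}`, `q₁ = t/s₁ < 1`, and at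
`s = s₂` the terms of negative index `m = -(n+1)` by `q₂^{n+1}`, `q₂ = s₂/t < 1`.  Both halves are
therefore absolutely summable (comparison with geometric series, `C` complete), the `ℤ`-indexed
series has sum `A + a₀ + B` (`HasSum.of_add_one_of_neg_add_one`), and by the ultrametric bound for
`tsum` (`IsUltrametricDist.norm_tsum_le_of_forall_le_of_nonneg`) `‖A‖ ≤ q₁`, `‖B‖ ≤ q₂`, whence
`‖A + B‖ ≤ max q₁ q₂ < 1`.  No limit `s → 1⁻` or `s → r⁺` is needed.

The closing theorem `WallLemma_proof` is stated STRUCTURALLY (the route decl's text verbatim), so that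
this module does not import the Theses file (the gate links `WallLemma_holds` by importing this module
into it); it is definitionally the route decl
`Summit.Langlands.Langlands.Theses.TriangulineChamber.WallLemma`.

References: standard non-archimedean function theory (e.g. the maximum principle on annuli,
Bosch–Güntzer–Remmert, *Non-Archimedean Analysis*, §9.7; Kedlaya–Pottharst–Xiao 2014 §2 for the
Robba-ring setting in which the route uses it).  Mathlib-sized; explanatory, not load-bearing for the
route's Assembly.
-/

set_option linter.dupNamespace false -- project-wide option (lakefile weak.linter.dupNamespace); `Summit.Langlands.Langlands` is the mandated namespace

namespace Summit.Langlands.Langlands.Theorems.WallLemma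

/-- One-term estimate [folklore]: in a normed field, if `‖a‖ * s ^ m ≤ 1` for a real radius `s > 0`
and an integer exponent `m`, then `‖a * x ^ m‖ ≤ (‖x‖ / s) ^ m` for every `x`.  (Write
`‖a‖ ‖x‖ᵐ = (‖a‖ sᵐ) · (‖x‖/s)ᵐ`.) -/
theorem norm_mul_zpow_le {C : Type*} [NormedField C] (a x : C) {s : ℝ} (hs : 0 < s) (m : ℤ)
    (h : ‖a‖ * s ^ m ≤ 1) : ‖a * x ^ m‖ ≤ (‖x‖ / s) ^ m := by
  rw [norm_mul, norm_zpow, div_zpow, le_div_iff₀ (zpow_pos hs m)]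
  calc ‖a‖ * ‖x‖ ^ m * s ^ m = (‖a‖ * s ^ m) * ‖x‖ ^ m := by ring
    _ ≤ 1 * ‖x‖ ^ m := mul_le_mul_of_nonneg_right h (zpow_nonneg (norm_nonneg x) m)
    _ = ‖x‖ ^ m := one_mul _

/-- Positive-index form of `norm_mul_zpow_le` [folklore]: `‖a‖ * s ^ (n+1) ≤ 1`, `s > 0` gives
`‖a * x ^ (n+1)‖ ≤ (‖x‖ / s) ^ (n+1)` with a natural-number exponent on the right. -/
theorem norm_mul_zpow_natSucc_le {C : Type*} [NormedField C] (a x : C) {s : ℝ} (hs : 0 < s)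
    (n : ℕ) (h : ‖a‖ * s ^ ((n : ℤ) + 1) ≤ 1) :
    ‖a * x ^ ((n : ℤ) + 1)‖ ≤ (‖x‖ / s) ^ (n + 1) := by
  have key := norm_mul_zpow_le a x hs ((n : ℤ) + 1) h
  have e : (‖x‖ / s) ^ ((n : ℤ) + 1) = (‖x‖ / s) ^ (n + 1) := by norm_cast
  rwa [e] at key

/-- Negative-index form of `norm_mul_zpow_le` [folklore]: `‖a‖ * s ^ (-(n+1)) ≤ 1`, `s > 0` gives
`‖a * x ^ (-(n+1))‖ ≤ (s / ‖x‖) ^ (n+1)`. -/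
theorem norm_mul_zpow_negSucc_le {C : Type*} [NormedField C] (a x : C) {s : ℝ} (hs : 0 < s)
    (n : ℕ) (h : ‖a‖ * s ^ (-((n : ℤ) + 1)) ≤ 1) :
    ‖a * x ^ (-((n : ℤ) + 1))‖ ≤ (s / ‖x‖) ^ (n + 1) := by
  have key := norm_mul_zpow_le a x hs (-((n : ℤ) + 1)) h
  have e : (‖x‖ / s) ^ (-((n : ℤ) + 1)) = (s / ‖x‖) ^ (n + 1) := by
    rw [zpow_neg, ← inv_zpow, inv_div]
    norm_cast
  rwa [e] at key

/-- **`WallLemma`** (item stmt-Langlands-8576 of route `TriangulineChamber`), text verbatim: a Laurent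
series `∑ₙ aₙ zⁿ` over a complete ultrametric nontrivially normed field, with `‖aₙ‖ sⁿ ≤ 1` for all
`r < s < 1` and all `n ∈ ℤ` (`0 ≤ r < 1`), converges at every `x` with `r < ‖x‖ < 1` and satisfies
`‖∑ₙ aₙ xⁿ − a₀‖ < 1` there (constant reduction on the open annulus).  Proof: geometric comparison at
the two auxiliary radii `(‖x‖+1)/2` and `(r+‖x‖)/2` plus the ultrametric `tsum` bound; see the module
docstring. [folklore] -/
theorem WallLemma_proof :
    ∀ (C : Type) [NontriviallyNormedField C] [IsUltrametricDist C] [CompleteSpace C] (a : ℤ → C) (r : ℝ), 0 ≤ r → r < 1 → (∀ s : ℝ, r < s → s < 1 → ∀ n : ℤ, ‖a n‖ * s ^ n ≤ 1) → ∀ x : C, r < ‖x‖ → ‖x‖ < 1 → Summable (fun n : ℤ => a n * x ^ n) ∧ ‖(∑' n : ℤ, a n * x ^ n) - a 0‖ < 1 := by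
  intro C _ _ _ a r hr0 _hr1 hb x hrx hx1
  have ht0 : 0 < ‖x‖ := lt_of_le_of_lt hr0 hrx
  -- the two auxiliary radii `s₁ ∈ (‖x‖, 1)` and `s₂ ∈ (r, ‖x‖)`
  set s₁ : ℝ := (‖x‖ + 1) / 2 with hs₁
  set s₂ : ℝ := (r + ‖x‖) / 2 with hs₂
  have hts₁ : ‖x‖ < s₁ := by rw [hs₁]; linarith
  have hs₁1 : s₁ < 1 := by rw [hs₁]; linarith
  have hrs₁ : r < s₁ := hrx.trans hts₁
  have hs₁0 : 0 < s₁ := ht0.trans hts₁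
  have hrs₂ : r < s₂ := by rw [hs₂]; linarith
  have hs₂t : s₂ < ‖x‖ := by rw [hs₂]; linarith
  have hs₂1 : s₂ < 1 := hs₂t.trans hx1
  have hs₂0 : 0 < s₂ := lt_of_le_of_lt hr0 hrs₂
  -- the two ratios `q₁ = ‖x‖ / s₁`, `q₂ = s₂ / ‖x‖`, both in `[0, 1)`
  set q₁ : ℝ := ‖x‖ / s₁ with hq₁
  set q₂ : ℝ := s₂ / ‖x‖ with hq₂
  have hq₁0 : 0 ≤ q₁ := div_nonneg ht0.le hs₁0.le
  have hq₁1 : q₁ < 1 := (div_lt_one hs₁0).mpr hts₁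
  have hq₂0 : 0 ≤ q₂ := div_nonneg hs₂0.le ht0.le
  have hq₂1 : q₂ < 1 := (div_lt_one ht0).mpr hs₂t
  -- the series and its termwise bounds
  set f : ℤ → C := fun n => a n * x ^ n with hf
  have hpos : ∀ n : ℕ, ‖f ((n : ℤ) + 1)‖ ≤ q₁ ^ (n + 1) := fun n =>
    norm_mul_zpow_natSucc_le (a ((n : ℤ) + 1)) x hs₁0 n (hb s₁ hrs₁ hs₁1 _)
  have hneg : ∀ n : ℕ, ‖f (-((n : ℤ) + 1))‖ ≤ q₂ ^ (n + 1) := fun n =>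
    norm_mul_zpow_negSucc_le (a (-((n : ℤ) + 1))) x hs₂0 n (hb s₂ hrs₂ hs₂1 _)
  -- both halves are absolutely summable (geometric comparison, `C` complete)
  have hA : Summable (fun n : ℕ => f ((n : ℤ) + 1)) :=
    Summable.of_norm_bounded ((summable_nat_add_iff 1).mpr (summable_geometric_of_lt_one hq₁0 hq₁1))
      hpos
  have hB : Summable (fun n : ℕ => f (-((n : ℤ) + 1))) :=
    Summable.of_norm_bounded ((summable_nat_add_iff 1).mpr (summable_geometric_of_lt_one hq₂0 hq₂1))
      hneg
  -- the `ℤ`-indexed sum splits as `A + f 0 + B`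
  have hsum : HasSum f ((∑' n : ℕ, f ((n : ℤ) + 1)) + f 0 + ∑' n : ℕ, f (-((n : ℤ) + 1))) :=
    HasSum.of_add_one_of_neg_add_one hA.hasSum hB.hasSum
  refine ⟨hsum.summable, ?_⟩
  -- ultrametric bounds on the two tails
  have hA1 : ‖∑' n : ℕ, f ((n : ℤ) + 1)‖ ≤ q₁ :=
    IsUltrametricDist.norm_tsum_le_of_forall_le_of_nonneg hq₁0
      fun n => (hpos n).trans (pow_le_of_le_one hq₁0 hq₁1.le (Nat.succ_ne_zero n))
  have hB1 : ‖∑' n : ℕ, f (-((n : ℤ) + 1))‖ ≤ q₂ :=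
    IsUltrametricDist.norm_tsum_le_of_forall_le_of_nonneg hq₂0
      fun n => (hneg n).trans (pow_le_of_le_one hq₂0 hq₂1.le (Nat.succ_ne_zero n))
  have hf0 : f 0 = a 0 := by simp [hf]
  rw [hsum.tsum_eq, hf0, show ∀ A B : C, A + a 0 + B - a 0 = A + B from fun A B => by ring]
  calc ‖(∑' n : ℕ, f ((n : ℤ) + 1)) + ∑' n : ℕ, f (-((n : ℤ) + 1))‖
      ≤ max ‖∑' n : ℕ, f ((n : ℤ) + 1)‖ ‖∑' n : ℕ, f (-((n : ℤ) + 1))‖ :=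
        IsUltrametricDist.norm_add_le_max _ _
    _ ≤ max q₁ q₂ := max_le_max hA1 hB1
    _ < 1 := max_lt hq₁1 hq₂1

end Summit.Langlands.Langlands.Theorems.WallLemma
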